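/-
Copyright (c) 2026 the pub-hodgecm-mathlib formalisation cell (harness21).  Prover seat hodgecm-mathlib-K2E3-p14 (g6), Track B "K2-LIT" ∕ h413
(`stmt-HodgeConjecture-24833`), line `K2_E3_EllipticInputs`, road (11-3-split-nsc), leaf (nsc-S-A′) "principal-block standard span", brick E2-I (part 2a):
INDUCTION IN STAGES FOR `B ≤ P₍₂,₁₎ ≤ GL₃(F)` — LEVI FACTORISATION IN `P₂₁` AND THE SCALAR IDENTITIES FOR `δ_{P₂₁}^{1∕2}`, `χ₃` ON `U_{P₂₁}`, `d(t)`, `ι(B₂)`.  2026-09-04.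
-/
import Summits.HodgeConjecture.HodgeConjecture.Theorems.K2E3GL3InductionInStagesEmbedding  -- ★ part 1: the injective `Φ`, `inducing_scalar_borel_eq`, block lemmas
import Literature.NumberTheory.Automorphic.ParabolicSemidirect                          -- ★ `leviEmbeddingP_inv_mul_mem_unipotentRadicalP`
import Literature.NumberTheory.Automorphic.GLnUnipotentRadicalRefinement                -- ★ `unipotentRadicalGL_comp_le`
import Literature.NumberTheory.Automorphic.UnipotentRadicalCompactOpenProofs            -- ★ `mem_unipotentRadicalGL_iff_entry`
import HarnessLib

/-!
# K2_E3 road (h413), (11-3-split-nsc) leaf (nsc-S-A′), brick E2-I (part 2a) — induction in stages `B ≤ P₍₂,₁₎ ≤ GL₃(F)`: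
# Levi factorisation in `P₂₁` and the scalar identities

Cell `pub/hodgecm-mathlib` (D-0151), Track B, seat K2E3-p14 (g6); leaf architecture K2E3-p25 (g0) `MEMO-SA-architecture.v1` brick E2, CONVENTIONS of the leaf
owner's HEADS line (K2 bus 2026-09-04 08:40:11Z): `I θ := parabolicIndGL F id (𝟙 ⊗ ∏ (θ a ∘ det ∘ eval a))`, inducing character `χ₃ = (x ⊗ y ⊗ z) ⊗ δ_B^{1∕2}` of
`I(x,y,z)` (all spelled INLINE — no definitions).  `--supports stmt-HodgeConjecture-24833 --as helper`; THEOREMS ONLY; never imports `Cruxes/…/Lines`.  COUNT-NEUTRAL.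

THE MATHEMATICS ([BernsteinZelevinsky1977, §2.1, 1.7, §2.3]; [Bump1997, §4.5]).  `Q = P₂₁ ≤ GL₃(F)` with Levi `GL₂ × GL₁`, block embeddings
`ι(g₂) = diag(g₂, 1)` (along a reindexing `e : Fin 2 ≃ {0,1}`) and `d(t) = diag(1,1,t)`.  This file is the bookkeeping behind the inverse of the induction-in-stages map
(part 2b, `K2E3GL3InductionInStagesEquiv`):
* §1 `exists_levi_factorisation_twoOne` — `q = ι(a) · d(t) · u`, `u ∈ U_{P₂₁}` (★ `leviEmbeddingP_inv_mul_mem_unipotentRadicalP`); `ι(a) d(t) = d(t) ι(a)`; entries of `ι(g₂)`,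
  `d(t)`; `ι(B₂) ⊆ B`; `U_{P₂₁} ≤ B` (★ `unipotentRadicalGL_comp_le`);
* §2 `δ_{P₂₁}^{1∕2}(u) = 1`, `δ_{P₂₁}^{1∕2}(d(t)) = ‖t‖⁻¹ = δ_B^{1∕2}(d(t))` (★ `rootDeltaChar_standardParabolicGL_bool`, ★ `rootDeltaChar_borel_three`);
  **`twist_three_blockScalar_true`** `χ₃(d(t)) = ‖t‖⁻¹ z(t)`; **`twist_three_eq_self_of_mem_unipotentRadicalGL`** `χ₃|_{U_{P₂₁}} = 1`;
  **`twist_three_blockEmbedding`** `χ₃(ι b₂) = δ_{P₂₁}^{1∕2}(ι b₂) · χ₂(b₂)` (part 1's `inducing_scalar_borel_eq` at `b = ι b₂`).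

HONEST LABEL: HC_CM is proved only modulo the 7 printed citations (2 remaining named inputs: hLiu418 = stmt-HodgeConjecture-24832, h413 =
stmt-HodgeConjecture-24833) until rung 0 closes; count-neutral helper.

## References
* [BernsteinZelevinsky1977] I. N. Bernstein, A. V. Zelevinsky, *Induced representations of reductive 𝔭-adic groups I*, Ann. Sci. ÉNS 10 (1977): §2.1, 1.7, Prop. 1.9, §2.3.
* [Bump1997] D. Bump, *Automorphic Forms and Representations* (1997): §4.5 (Frobenius reciprocity, induction in stages).
-/


set_option autoImplicit false
set_option linter.dupNamespace false

noncomputable section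

open scoped MatrixGroups NNReal

namespace Summit.HodgeConjecture.HodgeConjecture.Cruxes.H413.K2E3GL3InductionInStagesLevi

open Literature.NumberTheory.Automorphic
open Literature.NumberTheory.GaloisRepresentations Literature.NumberTheory.GaloisRepresentations.IsNonarchimedeanLocalField
open K2E3GL3InductionInStagesEmbedding

/-! ## §1 Block bookkeeping in `P₂₁ ≤ GL₃` -/

section Algebra

/-- A `Bool`-indexed family is the product of its two `mulSingle`s: `m = ι_false(m false) · ι_true(m true)`. [folklore] -/
theorem mulSingle_false_mul_mulSingle_true {M : Bool → Type*} [∀ a, MulOneClass (M a)] (m : Π a, M a) :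
    Pi.mulSingle false (m false) * Pi.mulSingle true (m true) = m := by
  funext b
  cases b <;> simp

/-- A `1 × 1` invertible matrix is the scalar `det`. [folklore] -/
theorem eq_scalar_det_of_subsingleton {n R : Type*} [Fintype n] [DecidableEq n] [Subsingleton n] [CommRing R] (g : GL n R) :
    g = Matrix.GeneralLinearGroup.scalar n (Matrix.GeneralLinearGroup.det g) := by
  ext i j
  obtain rfl : i = j := Subsingleton.elim i j
  rw [Matrix.GeneralLinearGroup.coe_scalar, Matrix.scalar_apply, Matrix.diagonal_apply_eq, Matrix.GeneralLinearGroup.val_det_apply,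
    Matrix.det_eq_elem_of_subsingleton _ i]

end Algebra

section Blocks

variable {F : Type*} [Field F] [ValuativeRel F] [TopologicalSpace F] [IsNonarchimedeanLocalField F]
  (e : Fin 2 ≃ {i : Fin 3 // (![false, false, true] : Fin 3 → Bool) i = false})
  (he : ∀ j : Fin 2, ((e j : {i : Fin 3 // (![false, false, true] : Fin 3 → Bool) i = false}) : Fin 3) = Fin.castSucc j)

omit [ValuativeRel F] [TopologicalSpace F] [IsNonarchimedeanLocalField F] in
/-- **Levi factorisation in `P₂₁`**: `q = ι(a) · d(t) · u` with `a` the `GL₂`-block of `q`, `t = det` of its `GL₁`-block, `d(t) = diag(1,1,t)` and `u ∈ U_{P₂₁}`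
(★ `leviEmbeddingP_inv_mul_mem_unipotentRadicalP`). [cite: BernsteinZelevinsky1977, §2.1] -/
theorem exists_levi_factorisation_twoOne (q : ↥(standardParabolicGL F (![false, false, true] : Fin 3 → Bool))) :
    ∃ u : ↥(standardParabolicGL F (![false, false, true] : Fin 3 → Bool)), u ∈ unipotentRadicalP F (![false, false, true] : Fin 3 → Bool) ∧
      q = (leviEmbeddingP F (![false, false, true] : Fin 3 → Bool) (Pi.mulSingle (M := (fun a : Bool => GL {i : Fin 3 // (![false, false, true] : Fin 3 → Bool) i = a} F)) false (leviProjection F (![false, false, true] : Fin 3 → Bool) q false))) * (leviEmbeddingP F (![false, false, true] : Fin 3 → Bool) (Pi.mulSingle (M := (fun a : Bool => GL {i : Fin 3 // (![false, false, true] : Fin 3 → Bool) i = a} F)) true (Matrix.GeneralLinearGroup.scalar {i : Fin 3 // (![false, false, true] : Fin 3 → Bool) i = true} (Matrix.GeneralLinearGroup.det (leviProjection F (![false, false, true] : Fin 3 → Bool) q true))))) * u := by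
  haveI := subsingleton_block_true
  refine ⟨_, leviEmbeddingP_inv_mul_mem_unipotentRadicalP q, ?_⟩
  rw [← eq_scalar_det_of_subsingleton, ← map_mul, mulSingle_false_mul_mulSingle_true, mul_inv_cancel_left]

omit [ValuativeRel F] [TopologicalSpace F] [IsNonarchimedeanLocalField F] in
/-- The two block embeddings commute: `ι(a) · d(t) = d(t) · ι(a)` (`mulSingle`s at different indices commute). [folklore] -/
theorem blockEmbedding_mul_blockScalar_comm (a : GL {i : Fin 3 // (![false, false, true] : Fin 3 → Bool) i = false} F) (t : Fˣ) :
    (leviEmbeddingP F (![false, false, true] : Fin 3 → Bool) (Pi.mulSingle (M := (fun a : Bool => GL {i : Fin 3 // (![false, false, true] : Fin 3 → Bool) i = a} F)) false a)) * (leviEmbeddingP F (![false, false, true] : Fin 3 → Bool) (Pi.mulSingle (M := (fun a : Bool => GL {i : Fin 3 // (![false, false, true] : Fin 3 → Bool) i = a} F)) true (Matrix.GeneralLinearGroup.scalar {i : Fin 3 // (![false, false, true] : Fin 3 → Bool) i = true} t))) = (leviEmbeddingP F (![false, false, true] : Fin 3 → Bool) (Pi.mulSingle (M := (fun a : Bool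 => GL {i : Fin 3 // (![false, false, true] : Fin 3 → Bool) i = a} F)) true (Matrix.GeneralLinearGroup.scalar {i : Fin 3 // (![false, false, true] : Fin 3 → Bool) i = true} t))) * (leviEmbeddingP F (![false, false, true] : Fin 3 → Bool) (Pi.mulSingle (M := (fun a : Bool => GL {i : Fin 3 // (![false, false, true] : Fin 3 → Bool) i = a} F)) false a)) := by
  rw [← map_mul, ← map_mul, (Pi.mulSingle_commute (show false ≠ true by decide) _ _).eq]

omit [ValuativeRel F] [TopologicalSpace F] [IsNonarchimedeanLocalField F] in
/-- `ι` is multiplicative: `ι(g₂ m) = ι(g₂) ι(m)`. [folklore] -/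
theorem blockEmbedding_mul (g₂ m : GL (Fin 2) F) : (leviEmbeddingP F (![false, false, true] : Fin 3 → Bool) (Pi.mulSingle (M := (fun a : Bool => GL {i : Fin 3 // (![false, false, true] : Fin 3 → Bool) i = a} F)) false (reindexGL e (g₂ * m)))) = (leviEmbeddingP F (![false, false, true] : Fin 3 → Bool) (Pi.mulSingle (M := (fun a : Bool => GL {i : Fin 3 // (![false, false, true] : Fin 3 → Bool) i = a} F)) false (reindexGL e g₂))) * (leviEmbeddingP F (![false, false, true] : Fin 3 → Bool) (Pi.mulSingle (M := (fun a : Bool => GL {i : Fin 3 // (![false, false, true] : Fin 3 → Bool) i = a} F)) false (reindexGL e m))) := by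
  rw [map_mul, Pi.mulSingle_mul, map_mul]

omit [ValuativeRel F] [TopologicalSpace F] [IsNonarchimedeanLocalField F] in
/-- The labelling `![false,false,true]` sends `castSucc i` (`i < 2`) to `false`. [folklore] -/
theorem twoOne_castSucc (i : Fin 2) : (![false, false, true] : Fin 3 → Bool) (Fin.castSucc i) = false := by
  fin_cases i <;> rfl

omit [ValuativeRel F] [TopologicalSpace F] [IsNonarchimedeanLocalField F] in
include he in
/-- Entries of `ι(g₂) = diag(g₂, 1)` in the `GL₂`-block: `ι(g₂)_{ij} = (g₂)_{ij}` for `i, j < 2`. [folklore] -/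
theorem blockEmbedding_apply_castSucc (g₂ : GL (Fin 2) F) (i j : Fin 2) :
    (((((leviEmbeddingP F (![false, false, true] : Fin 3 → Bool) (Pi.mulSingle (M := (fun a : Bool => GL {i : Fin 3 // (![false, false, true] : Fin 3 → Bool) i = a} F)) false (reindexGL e g₂))) : ↥(standardParabolicGL F (![false, false, true] : Fin 3 → Bool))) : GL (Fin 3) F)) : Matrix (Fin 3) (Fin 3) F) (Fin.castSucc i) (Fin.castSucc j) = ((g₂ : GL (Fin 2) F) : Matrix (Fin 2) (Fin 2) F) i j := by
  have h := leviProjection_apply_coe (R := F) (c := (![false, false, true] : Fin 3 → Bool)) (leviEmbeddingP F (![false, false, true] : Fin 3 → Bool) (Pi.mulSingle (M := (fun a : Bool => GL {i : Fin 3 // (![false, false, true] : Fin 3 → Bool) i = a} F)) false (reindexGL e g₂))) false ⟨Fin.castSucc i, twoOne_castSucc i⟩ ⟨Fin.castSucc j, twoOne_castSucc j⟩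
  dsimp only at h
  rw [← h, leviProjection_leviEmbeddingP_apply, Pi.mulSingle_eq_same, coe_reindexGL, Matrix.reindex_apply, Matrix.submatrix_apply]
  have hi : e.symm ⟨Fin.castSucc i, twoOne_castSucc i⟩ = i := by rw [Equiv.symm_apply_eq]; exact Subtype.ext (he i).symm
  have hj : e.symm ⟨Fin.castSucc j, twoOne_castSucc j⟩ = j := by rw [Equiv.symm_apply_eq]; exact Subtype.ext (he j).symm
  rw [hi, hj]

omit [ValuativeRel F] [TopologicalSpace F] [IsNonarchimedeanLocalField F] in
/-- The corner entry of `ι(g₂) = diag(g₂, 1)`: `ι(g₂)₂₂ = 1`. [folklore] -/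
theorem blockEmbedding_apply_two_two (g₂ : GL (Fin 2) F) :
    (((((leviEmbeddingP F (![false, false, true] : Fin 3 → Bool) (Pi.mulSingle (M := (fun a : Bool => GL {i : Fin 3 // (![false, false, true] : Fin 3 → Bool) i = a} F)) false (reindexGL e g₂))) : ↥(standardParabolicGL F (![false, false, true] : Fin 3 → Bool))) : GL (Fin 3) F)) : Matrix (Fin 3) (Fin 3) F) 2 2 = 1 := by
  have h := leviProjection_apply_coe (R := F) (c := (![false, false, true] : Fin 3 → Bool)) (leviEmbeddingP F (![false, false, true] : Fin 3 → Bool) (Pi.mulSingle (M := (fun a : Bool => GL {i : Fin 3 // (![false, false, true] : Fin 3 → Bool) i = a} F)) false (reindexGL e g₂))) true ⟨2, rfl⟩ ⟨2, rfl⟩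
  dsimp only at h
  rw [← h, leviProjection_leviEmbeddingP_apply, Pi.mulSingle_eq_of_ne (show true ≠ false by decide), Units.val_one, Matrix.one_apply_eq]

omit [ValuativeRel F] [TopologicalSpace F] [IsNonarchimedeanLocalField F] in
/-- The lower-left entries of `ι(g₂) = diag(g₂, 1)` vanish: `ι(g₂)_{2j} = 0` for `j < 2` (block triangularity). [folklore] -/
theorem blockEmbedding_apply_two_castSucc (g₂ : GL (Fin 2) F) (j : Fin 2) :
    (((((leviEmbeddingP F (![false, false, true] : Fin 3 → Bool) (Pi.mulSingle (M := (fun a : Bool => GL {i : Fin 3 // (![false, false, true] : Fin 3 → Bool) i = a} F)) false (reindexGL e g₂))) : ↥(standardParabolicGL F (![false, false, true] : Fin 3 → Bool))) : GL (Fin 3) F)) : Matrix (Fin 3) (Fin 3) F) 2 (Fin.castSucc j) = 0 :=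
  blockTriangular_of_mem (leviEmbeddingP F (![false, false, true] : Fin 3 → Bool) (Pi.mulSingle (M := (fun a : Bool => GL {i : Fin 3 // (![false, false, true] : Fin 3 → Bool) i = a} F)) false (reindexGL e g₂))) (show (![false, false, true] : Fin 3 → Bool) (Fin.castSucc j) < (![false, false, true] : Fin 3 → Bool) 2 by
    rw [twoOne_castSucc]; decide)

omit [ValuativeRel F] [TopologicalSpace F] [IsNonarchimedeanLocalField F] in
include he in
/-- **`ι(B₂) ⊆ B`**: for `b₂` in the Borel of `GL₂`, `ι(b₂) = diag(b₂, 1)` lies in the Borel of `GL₃`. [cite: BernsteinZelevinsky1977, §2.1] -/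
theorem blockEmbedding_borel_mem_borel (b₂ : ↥(standardParabolicGL F (id : Fin 2 → Fin 2))) : (((leviEmbeddingP F (![false, false, true] : Fin 3 → Bool) (Pi.mulSingle (M := (fun a : Bool => GL {i : Fin 3 // (![false, false, true] : Fin 3 → Bool) i = a} F)) false (reindexGL e (b₂ : GL (Fin 2) F)))) : ↥(standardParabolicGL F (![false, false, true] : Fin 3 → Bool))) : GL (Fin 3) F) ∈ (standardParabolicGL F (id : Fin 3 → Fin 3)) := by
  have h10 : (((((leviEmbeddingP F (![false, false, true] : Fin 3 → Bool) (Pi.mulSingle (M := (fun a : Bool => GL {i : Fin 3 // (![false, false, true] : Fin 3 → Bool) i = a} F)) false (reindexGL e (b₂ : GL (Fin 2) F)))) : ↥(standardParabolicGL F (![false, false, true] : Fin 3 → Bool))) : GL (Fin 3) F)) : Matrix (Fin 3) (Fin 3) F) 1 0 = 0 := by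
    have h := blockEmbedding_apply_castSucc e he (b₂ : GL (Fin 2) F) 1 0
    rw [Fin.castSucc_one, Fin.castSucc_zero] at h
    rw [h]
    exact blockTriangular_of_mem b₂ (show (id (0 : Fin 2)) < id (1 : Fin 2) by decide)
  have h20 : (((((leviEmbeddingP F (![false, false, true] : Fin 3 → Bool) (Pi.mulSingle (M := (fun a : Bool => GL {i : Fin 3 // (![false, false, true] : Fin 3 → Bool) i = a} F)) false (reindexGL e (b₂ : GL (Fin 2) F)))) : ↥(standardParabolicGL F (![false, false, true] : Fin 3 → Bool))) : GL (Fin 3) F)) : Matrix (Fin 3) (Fin 3) F) 2 0 = 0 := by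
    have h := blockEmbedding_apply_two_castSucc e (b₂ : GL (Fin 2) F) 0
    rwa [Fin.castSucc_zero] at h
  have h21 : (((((leviEmbeddingP F (![false, false, true] : Fin 3 → Bool) (Pi.mulSingle (M := (fun a : Bool => GL {i : Fin 3 // (![false, false, true] : Fin 3 → Bool) i = a} F)) false (reindexGL e (b₂ : GL (Fin 2) F)))) : ↥(standardParabolicGL F (![false, false, true] : Fin 3 → Bool))) : GL (Fin 3) F)) : Matrix (Fin 3) (Fin 3) F) 2 1 = 0 := by
    have h := blockEmbedding_apply_two_castSucc e (b₂ : GL (Fin 2) F) 1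
    rwa [Fin.castSucc_one] at h
  rw [mem_standardParabolicGL_iff]
  intro i j hij
  fin_cases i <;> fin_cases j <;> first | exact absurd hij (by decide) | assumption

omit [ValuativeRel F] [TopologicalSpace F] [IsNonarchimedeanLocalField F] in
/-- `d(t) = diag(1, 1, t)` as a matrix (★ `coe_leviEmbeddingP_mulSingle_scalar`). [cite: BernsteinZelevinsky1977, §2.1] -/
theorem coe_blockScalar_true (t : Fˣ) :
    (((((leviEmbeddingP F (![false, false, true] : Fin 3 → Bool) (Pi.mulSingle (M := (fun a : Bool => GL {i : Fin 3 // (![false, false, true] : Fin 3 → Bool) i = a} F)) true (Matrix.GeneralLinearGroup.scalar {i : Fin 3 // (![false, false, true] : Fin 3 → Bool) i = true} t))) : ↥(standardParabolicGL F (![false, false, true] : Fin 3 → Bool))) : GL (Fin 3) F)) : Matrix (Fin 3) (Fin 3) F) = Matrix.diagonal fun i => if (![false, false, true] : Fin 3 → Bool) i = true then (t : F) else 1 :=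
  coe_leviEmbeddingP_mulSingle_scalar F (![false, false, true] : Fin 3 → Bool) true t

omit [ValuativeRel F] [TopologicalSpace F] [IsNonarchimedeanLocalField F] in
/-- `d(t) = diag(1,1,t)` lies in the Borel of `GL₃`. [folklore] -/
theorem blockScalar_true_mem_borel (t : Fˣ) : (((leviEmbeddingP F (![false, false, true] : Fin 3 → Bool) (Pi.mulSingle (M := (fun a : Bool => GL {i : Fin 3 // (![false, false, true] : Fin 3 → Bool) i = a} F)) true (Matrix.GeneralLinearGroup.scalar {i : Fin 3 // (![false, false, true] : Fin 3 → Bool) i = true} t))) : ↥(standardParabolicGL F (![false, false, true] : Fin 3 → Bool))) : GL (Fin 3) F) ∈ (standardParabolicGL F (id : Fin 3 → Fin 3)) := by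
  rw [mem_standardParabolicGL_iff, coe_blockScalar_true]
  exact Matrix.blockTriangular_diagonal _

omit [ValuativeRel F] [TopologicalSpace F] [IsNonarchimedeanLocalField F] in
/-- Diagonal entries of `d(t) = diag(1,1,t)`: `d(t)₀₀ = 1`. [folklore] -/
theorem blockScalar_true_apply_zero_zero (t : Fˣ) : (((((leviEmbeddingP F (![false, false, true] : Fin 3 → Bool) (Pi.mulSingle (M := (fun a : Bool => GL {i : Fin 3 // (![false, false, true] : Fin 3 → Bool) i = a} F)) true (Matrix.GeneralLinearGroup.scalar {i : Fin 3 // (![false, false, true] : Fin 3 → Bool) i = true} t))) : ↥(standardParabolicGL F (![false, false, true] : Fin 3 → Bool))) : GL (Fin 3) F)) : Matrix (Fin 3) (Fin 3) F) 0 0 = 1 := by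
  rw [coe_blockScalar_true, Matrix.diagonal_apply_eq]
  simp

omit [ValuativeRel F] [TopologicalSpace F] [IsNonarchimedeanLocalField F] in
/-- Diagonal entries of `d(t) = diag(1,1,t)`: `d(t)₁₁ = 1`. [folklore] -/
theorem blockScalar_true_apply_one_one (t : Fˣ) : (((((leviEmbeddingP F (![false, false, true] : Fin 3 → Bool) (Pi.mulSingle (M := (fun a : Bool => GL {i : Fin 3 // (![false, false, true] : Fin 3 → Bool) i = a} F)) true (Matrix.GeneralLinearGroup.scalar {i : Fin 3 // (![false, false, true] : Fin 3 → Bool) i = true} t))) : ↥(standardParabolicGL F (![false, false, true] : Fin 3 → Bool))) : GL (Fin 3) F)) : Matrix (Fin 3) (Fin 3) F) 1 1 = 1 := by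
  rw [coe_blockScalar_true, Matrix.diagonal_apply_eq]
  simp

omit [ValuativeRel F] [TopologicalSpace F] [IsNonarchimedeanLocalField F] in
/-- Diagonal entries of `d(t) = diag(1,1,t)`: `d(t)₂₂ = t`. [folklore] -/
theorem blockScalar_true_apply_two_two (t : Fˣ) : (((((leviEmbeddingP F (![false, false, true] : Fin 3 → Bool) (Pi.mulSingle (M := (fun a : Bool => GL {i : Fin 3 // (![false, false, true] : Fin 3 → Bool) i = a} F)) true (Matrix.GeneralLinearGroup.scalar {i : Fin 3 // (![false, false, true] : Fin 3 → Bool) i = true} t))) : ↥(standardParabolicGL F (![false, false, true] : Fin 3 → Bool))) : GL (Fin 3) F)) : Matrix (Fin 3) (Fin 3) F) 2 2 = (t : F) := by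
  rw [coe_blockScalar_true, Matrix.diagonal_apply_eq]
  simp

omit [ValuativeRel F] [TopologicalSpace F] [IsNonarchimedeanLocalField F] in
/-- `U_{P₂₁} ≤ B` (★ `unipotentRadicalGL_comp_le`: `U_{P₂₁} ≤ U_B ≤ B`). [cite: BernsteinZelevinsky1977, §2.1] -/
theorem unipotentRadicalGL_twoOne_le_borel : unipotentRadicalGL F (![false, false, true] : Fin 3 → Bool) ≤ (standardParabolicGL F (id : Fin 3 → Fin 3)) :=
  (unipotentRadicalGL_comp_le (R := F) (id : Fin 3 → Fin 3) (f := (![false, false, true] : Fin 3 → Bool)) monotone_twoOne).trans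
    (unipotentRadicalGL_le F (id : Fin 3 → Fin 3))

omit [ValuativeRel F] [TopologicalSpace F] [IsNonarchimedeanLocalField F] in
/-- Diagonal entries of an element of `U_{P₂₁}` are `1`. [cite: BernsteinZelevinsky1977, §2.1] -/
theorem diag_eq_one_of_mem_unipotentRadicalGL (u : GL (Fin 3) F) (hu : u ∈ unipotentRadicalGL F (![false, false, true] : Fin 3 → Bool)) (i : Fin 3) :
    ((u : GL (Fin 3) F) : Matrix (Fin 3) (Fin 3) F) i i = 1 := by
  rw [mem_unipotentRadicalGL_iff_entry] at hu
  rw [hu.2 i i rfl, Matrix.one_apply_eq]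

end Blocks

/-! ## §2 The scalar identities: `δ_{P₂₁}^{1∕2}` and `χ₃` on `U_{P₂₁}`, on `d(t)`, and on `ι(B₂)` -/

section Scalars

variable {F : Type*} [Field F] [ValuativeRel F] [TopologicalSpace F] [IsNonarchimedeanLocalField F]
  (e : Fin 2 ≃ {i : Fin 3 // (![false, false, true] : Fin 3 → Bool) i = false})
  (he : ∀ j : Fin 2, ((e j : {i : Fin 3 // (![false, false, true] : Fin 3 → Bool) i = false}) : Fin 3) = Fin.castSucc j)

/-- `δ_{P₂₁}^{1∕2}(u) = 1` for `u ∈ U_{P₂₁}` (its diagonal blocks are identities; ★ `rootDeltaChar_standardParabolicGL_bool`). [cite: BernsteinZelevinsky1977, 1.7] -/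
theorem rootDeltaChar_twoOne_eq_one_of_mem_unipotentRadicalP (u : ↥(standardParabolicGL F (![false, false, true] : Fin 3 → Bool))) (hu : u ∈ unipotentRadicalP F (![false, false, true] : Fin 3 → Bool)) : (((rootDeltaChar (standardParabolicGL F (![false, false, true] : Fin 3 → Bool)) u : ℂˣ) : ℂ)) = 1 := by
  rw [rootDeltaChar_standardParabolicGL_bool, (MonoidHom.mem_ker).1 hu]
  simp

/-- `δ_{P₂₁}^{1∕2}(d(t)) = ‖t‖⁻¹` for `d(t) = diag(1,1,t)` (`(‖1‖^1 · (‖t‖^2)⁻¹)^{1∕2}`; ★ `rootDeltaChar_standardParabolicGL_bool`). [cite: BernsteinZelevinsky1977, 1.7] -/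
theorem rootDeltaChar_twoOne_blockScalar_true (t : Fˣ) :
    (((rootDeltaChar (standardParabolicGL F (![false, false, true] : Fin 3 → Bool)) (leviEmbeddingP F (![false, false, true] : Fin 3 → Bool) (Pi.mulSingle (M := (fun a : Bool => GL {i : Fin 3 // (![false, false, true] : Fin 3 → Bool) i = a} F)) true (Matrix.GeneralLinearGroup.scalar {i : Fin 3 // (![false, false, true] : Fin 3 → Bool) i = true} t))) : ℂˣ) : ℂ)) = ((((normAbs F (t : F))⁻¹ : ℝ≥0) : ℝ) : ℂ) := by
  have hcard1 : Fintype.card {i : Fin 3 // (![false, false, true] : Fin 3 → Bool) i = true} = 1 := by decide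
  have hcard2 : Fintype.card {i : Fin 3 // (![false, false, true] : Fin 3 → Bool) i = false} = 2 := by decide
  rw [rootDeltaChar_standardParabolicGL_bool, leviProjection_leviEmbeddingP_apply, Pi.mulSingle_eq_same,
    Pi.mulSingle_eq_of_ne (show false ≠ true by decide), map_one, Units.val_one, map_one, one_pow, one_mul, hcard2,
    Matrix.GeneralLinearGroup.val_det_apply, Matrix.GeneralLinearGroup.coe_scalar, Matrix.scalar_apply, Matrix.det_diagonal,
    Finset.prod_const, Finset.card_univ, hcard1, pow_one, NNReal.sqrt_inv, NNReal.sqrt_sq]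

/-- `δ_B^{1∕2}(d(t)) = ‖t‖⁻¹` for `d(t) = diag(1,1,t)` in the Borel of `GL₃` (★ `rootDeltaChar_borel_three`: `‖1‖ ‖t‖⁻¹`). [cite: BernsteinZelevinsky1977, 1.7] -/
theorem rootDeltaChar_borel_blockScalar_true (t : Fˣ) :
    ((rootDeltaChar (standardParabolicGL F (id : Fin 3 → Fin 3)) ⟨(((leviEmbeddingP F (![false, false, true] : Fin 3 → Bool) (Pi.mulSingle (M := (fun a : Bool => GL {i : Fin 3 // (![false, false, true] : Fin 3 → Bool) i = a} F)) true (Matrix.GeneralLinearGroup.scalar {i : Fin 3 // (![false, false, true] : Fin 3 → Bool) i = true} t))) : ↥(standardParabolicGL F (![false, false, true] : Fin 3 → Bool))) : GL (Fin 3) F), blockScalar_true_mem_borel t⟩ : ℂˣ) : ℂ) = ((((normAbs F (t : F))⁻¹ : ℝ≥0) : ℝ) : ℂ) := by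
  rw [K2E3GL3BorelModulus.rootDeltaChar_borel_three]
  dsimp only
  rw [blockScalar_true_apply_zero_zero, blockScalar_true_apply_two_two, map_one, one_mul]

/-- **`χ₃(d(t)) = ‖t‖⁻¹ · z(t)`**: the inducing character `χ₃ = (x ⊗ y ⊗ z) ⊗ δ_B^{1∕2}` of `I(x,y,z)` on `d(t) = diag(1,1,t)`. [cite: BernsteinZelevinsky1977, §2.3] -/
theorem twist_three_blockScalar_true (x y z : Fˣ →* ℂˣ) (t : Fˣ) (c : ℂ) :
    (Representation.twist (((Representation.trivial ℂ (Π a : Fin 3, GL {i : Fin 3 // (id : Fin 3 → Fin 3) i = a} F) ℂ).twist (∏ a : Fin 3, ((![x, y, z] : Fin 3 → (Fˣ →* ℂˣ)) a).comp (Matrix.GeneralLinearGroup.det.comp (Pi.evalMonoidHom (fun a : Fin 3 => GL {i : Fin 3 // (id : Fin 3 → Fin 3) i = a} F) a)))).comp (leviProjection F (id : Fin 3 → Fin 3))) (rootDeltaChar (standardParabolicGL F (id : Fin 3 → Fin 3)))) ⟨(((leviEmbeddingP F (![false, false, true] : Fin 3 → Bool) (Pi.mulSingle (M := (fun a : Bool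 => GL {i : Fin 3 // (![false, false, true] : Fin 3 → Bool) i = a} F)) true (Matrix.GeneralLinearGroup.scalar {i : Fin 3 // (![false, false, true] : Fin 3 → Bool) i = true} t))) : ↥(standardParabolicGL F (![false, false, true] : Fin 3 → Bool))) : GL (Fin 3) F), blockScalar_true_mem_borel t⟩ c = ((((normAbs F (t : F))⁻¹ : ℝ≥0) : ℝ) : ℂ) * ((((z t : ℂˣ) : ℂ)) * c) := by
  have hu0 : Matrix.GeneralLinearGroup.det (leviProjection F (id : Fin 3 → Fin 3) ⟨(((leviEmbeddingP F (![false, false, true] : Fin 3 → Bool) (Pi.mulSingle (M := (fun a : Bool => GL {i : Fin 3 // (![false, false, true] : Fin 3 → Bool) i = a} F)) true (Matrix.GeneralLinearGroup.scalar {i : Fin 3 // (![false, false, true] : Fin 3 → Bool) i = true} t))) : ↥(standardParabolicGL F (![false, false, true] : Fin 3 → Bool))) : GL (Fin 3) F), blockScalar_true_mem_borel t⟩ 0) = 1 :=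
    Units.ext (by rw [det_leviProjection_id_eq_entry, Units.val_one]; exact blockScalar_true_apply_zero_zero t)
  have hu1 : Matrix.GeneralLinearGroup.det (leviProjection F (id : Fin 3 → Fin 3) ⟨(((leviEmbeddingP F (![false, false, true] : Fin 3 → Bool) (Pi.mulSingle (M := (fun a : Bool => GL {i : Fin 3 // (![false, false, true] : Fin 3 → Bool) i = a} F)) true (Matrix.GeneralLinearGroup.scalar {i : Fin 3 // (![false, false, true] : Fin 3 → Bool) i = true} t))) : ↥(standardParabolicGL F (![false, false, true] : Fin 3 → Bool))) : GL (Fin 3) F), blockScalar_true_mem_borel t⟩ 1) = 1 :=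
    Units.ext (by rw [det_leviProjection_id_eq_entry, Units.val_one]; exact blockScalar_true_apply_one_one t)
  have hu2 : Matrix.GeneralLinearGroup.det (leviProjection F (id : Fin 3 → Fin 3) ⟨(((leviEmbeddingP F (![false, false, true] : Fin 3 → Bool) (Pi.mulSingle (M := (fun a : Bool => GL {i : Fin 3 // (![false, false, true] : Fin 3 → Bool) i = a} F)) true (Matrix.GeneralLinearGroup.scalar {i : Fin 3 // (![false, false, true] : Fin 3 → Bool) i = true} t))) : ↥(standardParabolicGL F (![false, false, true] : Fin 3 → Bool))) : GL (Fin 3) F), blockScalar_true_mem_borel t⟩ 2) = t :=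
    Units.ext (by rw [det_leviProjection_id_eq_entry]; exact blockScalar_true_apply_two_two t)
  rw [Representation.twist_apply, rootDeltaChar_borel_blockScalar_true]
  simp only [MonoidHom.coe_comp, Function.comp_apply, Representation.twist_apply, Representation.trivial_apply, smul_eq_mul,
    Fin.prod_univ_three, Matrix.cons_val_zero, Matrix.cons_val_one, Matrix.cons_val_two, Matrix.head_cons, Matrix.tail_cons,
    MonoidHom.mul_apply, Pi.evalMonoidHom_apply, hu0, hu1, hu2, map_one, one_mul]

/-- **`χ₃|_{U_{P₂₁}} = 1`**: the inducing character of `I(x,y,z)` is trivial on `U_{P₂₁} ⊆ U_B` (diagonal entries `1`, so `δ_B^{1∕2} = 1` and `(x ⊗ y ⊗ z) = 1`).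
[cite: BernsteinZelevinsky1977, §2.3] -/
theorem twist_three_eq_self_of_mem_unipotentRadicalGL (x y z : Fˣ →* ℂˣ) (u : GL (Fin 3) F) (hu : u ∈ unipotentRadicalGL F (![false, false, true] : Fin 3 → Bool)) (c : ℂ) :
    (Representation.twist (((Representation.trivial ℂ (Π a : Fin 3, GL {i : Fin 3 // (id : Fin 3 → Fin 3) i = a} F) ℂ).twist (∏ a : Fin 3, ((![x, y, z] : Fin 3 → (Fˣ →* ℂˣ)) a).comp (Matrix.GeneralLinearGroup.det.comp (Pi.evalMonoidHom (fun a : Fin 3 => GL {i : Fin 3 // (id : Fin 3 → Fin 3) i = a} F) a)))).comp (leviProjection F (id : Fin 3 → Fin 3))) (rootDeltaChar (standardParabolicGL F (id : Fin 3 → Fin 3)))) ⟨u, unipotentRadicalGL_twoOne_le_borel hu⟩ c = c := by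
  have hd : ∀ a : Fin 3, Matrix.GeneralLinearGroup.det (leviProjection F (id : Fin 3 → Fin 3) ⟨u, unipotentRadicalGL_twoOne_le_borel hu⟩ a) = 1 :=
    fun a => Units.ext (by rw [det_leviProjection_id_eq_entry, Units.val_one]; exact diag_eq_one_of_mem_unipotentRadicalGL u hu a)
  rw [Representation.twist_apply, K2E3GL3BorelModulus.rootDeltaChar_borel_three]
  dsimp only
  rw [diag_eq_one_of_mem_unipotentRadicalGL u hu 0, diag_eq_one_of_mem_unipotentRadicalGL u hu 2, map_one, inv_one, mul_one]
  simp only [MonoidHom.coe_comp, Function.comp_apply, Representation.twist_apply, Representation.trivial_apply, smul_eq_mul,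
    Fin.prod_univ_three, Matrix.cons_val_zero, Matrix.cons_val_one, Matrix.cons_val_two, Matrix.head_cons, Matrix.tail_cons,
    MonoidHom.mul_apply, Pi.evalMonoidHom_apply, hd, map_one, one_mul, Units.val_one, NNReal.coe_one, Complex.ofReal_one]

include he in
/-- **`χ₃(ι b₂) = δ_{P₂₁}^{1∕2}(ι b₂) · χ₂(b₂)`** for `b₂` in the Borel of `GL₂` — part 1's `inducing_scalar_borel_eq` at `b = ι(b₂) = diag(b₂, 1)` (whose `GL₁`-block is `1`
and whose `GL₂`-block is `b₂`). [cite: BernsteinZelevinsky1977, Prop. 1.9, §2.3] -/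
theorem twist_three_blockEmbedding (x y z : Fˣ →* ℂˣ) (b₂ : ↥(standardParabolicGL F (id : Fin 2 → Fin 2))) (c : ℂ) :
    (Representation.twist (((Representation.trivial ℂ (Π a : Fin 3, GL {i : Fin 3 // (id : Fin 3 → Fin 3) i = a} F) ℂ).twist (∏ a : Fin 3, ((![x, y, z] : Fin 3 → (Fˣ →* ℂˣ)) a).comp (Matrix.GeneralLinearGroup.det.comp (Pi.evalMonoidHom (fun a : Fin 3 => GL {i : Fin 3 // (id : Fin 3 → Fin 3) i = a} F) a)))).comp (leviProjection F (id : Fin 3 → Fin 3))) (rootDeltaChar (standardParabolicGL F (id : Fin 3 → Fin 3)))) ⟨(((leviEmbeddingP F (![false, false, true] : Fin 3 → Bool) (Pi.mulSingle (M := (fun a : Bool => GL {i : Fin 3 // (![false, false, true] : Fin 3 → Bool) i = a} F)) false (reindexGL e (b₂ : GL (Fin 2) F)))) : ↥(standardParabolicGL F (![false, false, true] : Fin 3 → Bool))) : GL (Fin 3) F), blockEmbedding_borel_mem_borel e he b₂⟩ c = (((rootDeltaChar (standardParabolicGL F (![false, false, true] : Fin 3 → Bool)) (leviEmbeddingP F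 (![false, false, true] : Fin 3 → Bool) (Pi.mulSingle (M := (fun a : Bool => GL {i : Fin 3 // (![false, false, true] : Fin 3 → Bool) i = a} F)) false (reindexGL e (b₂ : GL (Fin 2) F)))) : ℂˣ) : ℂ)) * (Representation.twist (((Representation.trivial ℂ (Π a : Fin 2, GL {i : Fin 2 // (id : Fin 2 → Fin 2) i = a} F) ℂ).twist (∏ a : Fin 2, ((![x, y] : Fin 2 → (Fˣ →* ℂˣ)) a).comp (Matrix.GeneralLinearGroup.det.comp (Pi.evalMonoidHom (fun a : Fin 2 => GL {i : Fin 2 // (id : Fin 2 → Fin 2) i = a} F) a)))).comp (leviProjection F (id : Fin 2 → Fin 2))) (rootDeltaChar (standardParabolicGL F (id : Fin 2 → Fin 2)))) b₂ c := by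
  have h := inducing_scalar_borel_eq e he x y z ⟨(((leviEmbeddingP F (![false, false, true] : Fin 3 → Bool) (Pi.mulSingle (M := (fun a : Bool => GL {i : Fin 3 // (![false, false, true] : Fin 3 → Bool) i = a} F)) false (reindexGL e (b₂ : GL (Fin 2) F)))) : ↥(standardParabolicGL F (![false, false, true] : Fin 3 → Bool))) : GL (Fin 3) F), blockEmbedding_borel_mem_borel e he b₂⟩ c
  have hq : ∀ hmem, (⟨(((leviEmbeddingP F (![false, false, true] : Fin 3 → Bool) (Pi.mulSingle (M := (fun a : Bool => GL {i : Fin 3 // (![false, false, true] : Fin 3 → Bool) i = a} F)) false (reindexGL e (b₂ : GL (Fin 2) F)))) : ↥(standardParabolicGL F (![false, false, true] : Fin 3 → Bool))) : GL (Fin 3) F), hmem⟩ : ↥(standardParabolicGL F (![false, false, true] : Fin 3 → Bool))) = (leviEmbeddingP F (![false, false, true] : Fin 3 → Bool) (Pi.mulSingle (M := (fun a : Bool => GL {i : Fin 3 // (![false, false, true] : Fin 3 → Bool) i = a} F)) false (reindexGL e (b₂ : GL (Fin 2) F)))) := fun _ => rfl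
  simp only [hq, leviProjection_leviEmbeddingP_apply, Pi.mulSingle_eq_same, Pi.mulSingle_eq_of_ne (show true ≠ false by decide),
    MonoidHom.coe_comp, Function.comp_apply, Pi.evalMonoidHom_apply, map_one, Units.val_one, one_mul, MulEquiv.symm_apply_apply,
    Subtype.coe_eta] at h
  rw [Representation.twist_apply, Representation.twist_apply]
  simp only [MonoidHom.coe_comp, Function.comp_apply, Representation.twist_apply, Representation.trivial_apply, smul_eq_mul]
  rw [← h]

end Scalars


end Summit.HodgeConjecture.HodgeConjecture.Cruxes.H413.K2E3GL3InductionInStagesLevi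

end
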